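import Mathlib.InformationTheory.KullbackLeibler.Basic
import Literature.MathematicalPhysics.KineticTheory.HardSphereEulerProofs
import Literature.Analysis.FluidPDE.HardSphereDynamicsProofs
import Literature.Analysis.FluidPDE.BoltzmannEquationProofs
import Literature.Analysis.FunctionSpaces.TorusCalculusProofs
import Summits.AtomisticToContinuum.HydrodynamicLimit.Theorems.CollisionIsometryCLTMacroClosureStubLedgerCalculus
import HarnessLib

/-!
# Stub `stub_ledger` of the line `IdeatorTwoSketch` (crux `MacroClosure`), part 4: the log-partition
calculus for a Gaussian-dominated family of one-particle log-densities

Support file (`--supports stmt-AtomisticToContinuum-14870`) for the registered stub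
`stub_ledger : LedgerIdentity` (conjunct (L2)). Generic core: a time-dependent one-particle
log-density `ψ : ℝ → 𝕋³ × ℝ³ → ℝ` with time derivative `ψ'` within a convex time set `S` such that

* (H1) `s ↦ ψ s y` has derivative `ψ' s y` within `S` on `S`, for every `y`;
* (H2) `|ψ' s (x, v)| ≤ C₁ (1 + |v|²)` on `S` (quadratic velocity growth of the score);
* (H3) `ψ s (x, v) ≤ C₂ − b |v|²` on `S` with `b > 0` (Gaussian domination);
* (H4) `ψ s`, `ψ' s` measurable for `s ∈ S`; (H5) `s ↦ ψ' s y` continuous on `S`.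

Then the unnormalised `(N+1)`-particle weight `F s z = 𝟙_D(z) exp(∑ₖ ψ s zₖ)` (`D` any measurable
set of configurations, e.g. the hard-sphere domain) satisfies: `s ↦ ∫ F s dz` is differentiable
within `S` with derivative `∫ 𝟙_D exp(∑ₖ ψ s zₖ) ∑ₖ ψ' s zₖ dz`
(`hasDerivWithinAt_integral_indicator_exp_sum`), and the latter is continuous on `S`
(`continuousOn_integral_indicator_exp_sum_mul`). Tools: part 3
(`hasDerivWithinAt_integral_of_dominated_convex`), the product Gaussian majorant
`M ∏ₖ e^{-(b/2)|vₖ|²}` (integrable on `(𝕋³ × ℝ³)^{N+1}` by `Integrable.fintype_prod` and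
`Literature.Analysis.FluidPDE.integrable_exp_neg_mul_sq_norm`), dominated convergence.
-/

noncomputable section

open MeasureTheory Filter Set Topology
open scoped ENNReal ContDiff InnerProductSpace

namespace Summit.AtomisticToContinuum.HydrodynamicLimit.Theorems.MacroClosureLine

open Literature.MathematicalPhysics.KineticTheory Literature.Analysis.FluidPDE
open Literature.Analysis.FunctionSpaces

namespace StubLedger

/-! ## Gaussian weights on phase space -/

/-- The Gaussian velocity weight `e^{-b|v|²}` is integrable on the one-particle phase space
`𝕋³ × ℝ³` (the velocity factor is `Literature.Analysis.FluidPDE.integrable_exp_neg_mul_sq_norm`).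
[folklore] -/
theorem integrable_exp_neg_mul_sq_norm_snd {b : ℝ} (hb : 0 < b) :
    Integrable (fun y : T3 × V3 => Real.exp (-b * ‖y.2‖ ^ 2)) := by
  have h := (integrable_const (1 : ℝ) : Integrable (fun _ : T3 => (1 : ℝ))).mul_prod
    (integrable_exp_neg_mul_sq_norm (E := V3) hb)
  rw [MeasureTheory.Measure.volume_eq_prod]
  simpa using h

/-- The product Gaussian weight `∏ₖ e^{-b|vₖ|²}` is integrable on `(𝕋³ × ℝ³)ⁿ`. [folklore] -/
theorem integrable_prod_exp_neg_mul_sq_norm (n : ℕ) {b : ℝ} (hb : 0 < b) :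
    Integrable (fun z : Config n (Fin 3) T3 => ∏ k, Real.exp (-b * ‖(z k).2‖ ^ 2)) := by
  haveI : SigmaFinite (volume : Measure (T3 × V3)) := inferInstance
  exact Integrable.fintype_prod (f := fun _ : Fin n => fun y : T3 × V3 => Real.exp (-b * ‖y.2‖ ^ 2))
    fun _ => integrable_exp_neg_mul_sq_norm_snd hb

/-- `1 + x ≤ (1 + c⁻¹) e^{c x}` for `x ≥ 0`, `c > 0`. [folklore] -/
theorem one_add_le_mul_exp {c x : ℝ} (hc : 0 < c) (hx : 0 ≤ x) :
    1 + x ≤ (1 + c⁻¹) * Real.exp (c * x) := by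
  have h1 : c * x + 1 ≤ Real.exp (c * x) := Real.add_one_le_exp _
  have h2 : 1 ≤ Real.exp (c * x) := Real.one_le_exp (by positivity)
  have h3 : c * x ≤ Real.exp (c * x) := by linarith
  have h4 : x ≤ c⁻¹ * Real.exp (c * x) := by
    calc x = c⁻¹ * (c * x) := by field_simp
      _ ≤ c⁻¹ * Real.exp (c * x) := mul_le_mul_of_nonneg_left h3 (inv_nonneg.2 hc.le)
  calc 1 + x ≤ Real.exp (c * x) + c⁻¹ * Real.exp (c * x) := add_le_add h2 h4
    _ = (1 + c⁻¹) * Real.exp (c * x) := by ring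

/-! ## The weight `F s z = 𝟙_D(z) exp(∑ₖ ψ s zₖ)` and its time derivative -/

section Core

variable {N : ℕ}

/-- (H1) ⇒ pointwise time derivative of the weight:
`∂ₛ [𝟙_D exp(∑ₖ ψ s zₖ)] = 𝟙_D exp(∑ₖ ψ s zₖ) ∑ₖ ψ' s zₖ` within `S`. [folklore] -/
theorem hasDerivWithinAt_indicator_exp_sum (D : Set (Config (N + 1) (Fin 3) T3)) {S : Set ℝ}
    {ψ ψ' : ℝ → T3 × V3 → ℝ} (hψ : ∀ y, ∀ s ∈ S, HasDerivWithinAt (fun s => ψ s y) (ψ' s y) S s)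
    (z : Config (N + 1) (Fin 3) T3) {s : ℝ} (hs : s ∈ S) :
    HasDerivWithinAt (fun s => D.indicator (fun z => Real.exp (∑ k, ψ s (z k))) z)
      (D.indicator (fun z => Real.exp (∑ k, ψ s (z k)) * ∑ k, ψ' s (z k)) z) S s := by
  by_cases hz : z ∈ D
  · simp only [Set.indicator_of_mem hz]
    exact (HasDerivWithinAt.fun_sum fun k _ => hψ (z k) s hs).exp
  · simp only [Set.indicator_of_notMem hz]
    exact hasDerivWithinAt_const s S 0

/-- (H3) ⇒ Gaussian bound on the weight: `|F s z| ≤ e^{(N+1)C₂} ∏ₖ e^{-b|vₖ|²}`. [folklore] -/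
theorem norm_indicator_exp_sum_le (D : Set (Config (N + 1) (Fin 3) T3)) {S : Set ℝ}
    {ψ : ℝ → T3 × V3 → ℝ} {C₂ b : ℝ} (hψle : ∀ s ∈ S, ∀ y, ψ s y ≤ C₂ - b * ‖y.2‖ ^ 2)
    {s : ℝ} (hs : s ∈ S) (z : Config (N + 1) (Fin 3) T3) :
    ‖D.indicator (fun z => Real.exp (∑ k, ψ s (z k))) z‖ ≤
      Real.exp (((N : ℝ) + 1) * C₂) * ∏ k, Real.exp (-b * ‖(z k).2‖ ^ 2) := by
  refine (norm_indicator_le_norm_self _ _).trans ?_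
  rw [Real.norm_eq_abs, abs_of_pos (Real.exp_pos _), ← Real.exp_sum, ← Real.exp_add]
  refine Real.exp_le_exp.2 ?_
  calc ∑ k, ψ s (z k) ≤ ∑ k : Fin (N + 1), (C₂ - b * ‖(z k).2‖ ^ 2) :=
        Finset.sum_le_sum fun k _ => hψle s hs (z k)
    _ = ((N : ℝ) + 1) * C₂ + ∑ k, -b * ‖(z k).2‖ ^ 2 := by
        rw [Finset.sum_sub_distrib, Finset.sum_const, Finset.card_univ, Fintype.card_fin,
          nsmul_eq_mul]
        push_cast
        simp [Finset.sum_neg_distrib, sub_eq_add_neg]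

/-- (H2), (H3) ⇒ Gaussian bound on the time derivative of the weight:
`|F' s z| ≤ M ∏ₖ e^{-(b/2)|vₖ|²}` with `M = e^{(N+1)C₂} C₁ (1 + (b/2)⁻¹) (N+1)`. [folklore] -/
theorem norm_indicator_exp_sum_mul_le (D : Set (Config (N + 1) (Fin 3) T3)) {S : Set ℝ}
    {ψ ψ' : ℝ → T3 × V3 → ℝ} {C₁ C₂ b : ℝ} (hC₁ : 0 ≤ C₁) (hb : 0 < b)
    (hψ' : ∀ s ∈ S, ∀ y, |ψ' s y| ≤ C₁ * (1 + ‖y.2‖ ^ 2))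
    (hψle : ∀ s ∈ S, ∀ y, ψ s y ≤ C₂ - b * ‖y.2‖ ^ 2)
    {s : ℝ} (hs : s ∈ S) (z : Config (N + 1) (Fin 3) T3) :
    ‖D.indicator (fun z => Real.exp (∑ k, ψ s (z k)) * ∑ k, ψ' s (z k)) z‖ ≤
      (Real.exp (((N : ℝ) + 1) * C₂) * (C₁ * (1 + (b / 2)⁻¹) * ((N : ℝ) + 1))) *
        ∏ k, Real.exp (-(b / 2) * ‖(z k).2‖ ^ 2) := by
  have hc : 0 < b / 2 := half_pos hb
  set X : ℝ := ∑ k, ‖(z k).2‖ ^ 2 with hX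
  have hX0 : 0 ≤ X := Finset.sum_nonneg fun k _ => sq_nonneg _
  -- the exponential factor
  have hexp : Real.exp (∑ k, ψ s (z k)) ≤ Real.exp (((N : ℝ) + 1) * C₂) * Real.exp (-b * X) := by
    have h := norm_indicator_exp_sum_le (Set.univ : Set (Config (N + 1) (Fin 3) T3)) hψle hs z
    rw [Set.indicator_of_mem (Set.mem_univ _), Real.norm_eq_abs, abs_of_pos (Real.exp_pos _)] at h
    refine h.trans_eq ?_
    rw [← Real.exp_sum, hX, Finset.mul_sum]
  -- the polynomial factor
  have hpoly : |∑ k, ψ' s (z k)| ≤ C₁ * (1 + (b / 2)⁻¹) * ((N : ℝ) + 1) * Real.exp (b / 2 * X) := by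
    calc |∑ k, ψ' s (z k)| ≤ ∑ k, |ψ' s (z k)| := Finset.abs_sum_le_sum_abs _ _
      _ ≤ ∑ k, C₁ * ((1 + (b / 2)⁻¹) * Real.exp (b / 2 * X)) := by
          refine Finset.sum_le_sum fun k _ => (hψ' s hs (z k)).trans ?_
          refine mul_le_mul_of_nonneg_left ((one_add_le_mul_exp hc (sq_nonneg _)).trans ?_) hC₁
          refine mul_le_mul_of_nonneg_left (Real.exp_le_exp.2 ?_) (by positivity)
          exact mul_le_mul_of_nonneg_left
            (Finset.single_le_sum (fun j _ => sq_nonneg ‖(z j).2‖) (Finset.mem_univ k)) hc.le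
      _ = C₁ * (1 + (b / 2)⁻¹) * ((N : ℝ) + 1) * Real.exp (b / 2 * X) := by
          rw [Finset.sum_const, Finset.card_univ, Fintype.card_fin, nsmul_eq_mul]
          push_cast
          ring
  refine (norm_indicator_le_norm_self _ _).trans ?_
  rw [norm_mul, Real.norm_eq_abs, abs_of_pos (Real.exp_pos _), Real.norm_eq_abs]
  calc Real.exp (∑ k, ψ s (z k)) * |∑ k, ψ' s (z k)|
      ≤ (Real.exp (((N : ℝ) + 1) * C₂) * Real.exp (-b * X)) *
          (C₁ * (1 + (b / 2)⁻¹) * ((N : ℝ) + 1) * Real.exp (b / 2 * X)) :=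
        mul_le_mul hexp hpoly (abs_nonneg _) (by positivity)
    _ = (Real.exp (((N : ℝ) + 1) * C₂) * (C₁ * (1 + (b / 2)⁻¹) * ((N : ℝ) + 1))) *
          Real.exp (-(b / 2) * X) := by
        have : Real.exp (-b * X) * Real.exp (b / 2 * X) = Real.exp (-(b / 2) * X) := by
          rw [← Real.exp_add]; congr 1; ring
        rw [← this]; ring
    _ = _ := by
        rw [hX, Finset.mul_sum, Real.exp_sum]

/-- (H4) ⇒ the weight is measurable. [folklore] -/
theorem measurable_indicator_exp_sum {D : Set (Config (N + 1) (Fin 3) T3)} (hD : MeasurableSet D)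
    {ψ : ℝ → T3 × V3 → ℝ} {s : ℝ} (hm : Measurable (ψ s)) :
    Measurable fun z => D.indicator (fun z => Real.exp (∑ k, ψ s (z k))) z :=
  (Real.measurable_exp.comp (Finset.measurable_sum _ fun k _ => hm.comp (measurable_pi_apply k))).indicator hD

/-- (H4) ⇒ the time derivative of the weight is measurable. [folklore] -/
theorem measurable_indicator_exp_sum_mul {D : Set (Config (N + 1) (Fin 3) T3)}
    (hD : MeasurableSet D) {ψ ψ' : ℝ → T3 × V3 → ℝ} {s : ℝ} (hm : Measurable (ψ s))
    (hm' : Measurable (ψ' s)) :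
    Measurable fun z => D.indicator (fun z => Real.exp (∑ k, ψ s (z k)) * ∑ k, ψ' s (z k)) z :=
  ((Real.measurable_exp.comp (Finset.measurable_sum _ fun k _ => hm.comp (measurable_pi_apply k))).mul
    (Finset.measurable_sum _ fun k _ => hm'.comp (measurable_pi_apply k))).indicator hD

/-- (H3), (H4) ⇒ the weight is integrable for `s ∈ S`. [folklore] -/
theorem integrable_indicator_exp_sum {D : Set (Config (N + 1) (Fin 3) T3)} (hD : MeasurableSet D)
    {S : Set ℝ} {ψ : ℝ → T3 × V3 → ℝ} {C₂ b : ℝ} (hb : 0 < b)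
    (hψle : ∀ s ∈ S, ∀ y, ψ s y ≤ C₂ - b * ‖y.2‖ ^ 2) (hm : ∀ s ∈ S, Measurable (ψ s))
    {s : ℝ} (hs : s ∈ S) :
    Integrable fun z => D.indicator (fun z => Real.exp (∑ k, ψ s (z k))) z :=
  Integrable.mono' ((integrable_prod_exp_neg_mul_sq_norm (N + 1) hb).const_mul _)
    (measurable_indicator_exp_sum hD (hm s hs)).aestronglyMeasurable
    (ae_of_all _ fun z => norm_indicator_exp_sum_le D hψle hs z)

/-- (H2)–(H4) ⇒ the time derivative of the weight is integrable for `s ∈ S`. [folklore] -/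
theorem integrable_indicator_exp_sum_mul {D : Set (Config (N + 1) (Fin 3) T3)}
    (hD : MeasurableSet D) {S : Set ℝ} {ψ ψ' : ℝ → T3 × V3 → ℝ} {C₁ C₂ b : ℝ} (hC₁ : 0 ≤ C₁)
    (hb : 0 < b) (hψ' : ∀ s ∈ S, ∀ y, |ψ' s y| ≤ C₁ * (1 + ‖y.2‖ ^ 2))
    (hψle : ∀ s ∈ S, ∀ y, ψ s y ≤ C₂ - b * ‖y.2‖ ^ 2) (hm : ∀ s ∈ S, Measurable (ψ s))
    (hm' : ∀ s ∈ S, Measurable (ψ' s)) {s : ℝ} (hs : s ∈ S) :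
    Integrable fun z => D.indicator (fun z => Real.exp (∑ k, ψ s (z k)) * ∑ k, ψ' s (z k)) z :=
  Integrable.mono' ((integrable_prod_exp_neg_mul_sq_norm (N + 1) (half_pos hb)).const_mul _)
    (measurable_indicator_exp_sum_mul hD (hm s hs) (hm' s hs)).aestronglyMeasurable
    (ae_of_all _ fun z => norm_indicator_exp_sum_mul_le D hC₁ hb hψ' hψle hs z)

/-- **Differentiation of the partition integral.** Under (H1)–(H4) on a convex time set `S`,
`s ↦ ∫ 𝟙_D exp(∑ₖ ψ s zₖ) dz` has derivative `∫ 𝟙_D exp(∑ₖ ψ s zₖ) ∑ₖ ψ' s zₖ dz` within `S` at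
every `s ∈ S` (dominated differentiation, part 3). [folklore] -/
theorem hasDerivWithinAt_integral_indicator_exp_sum {D : Set (Config (N + 1) (Fin 3) T3)}
    (hD : MeasurableSet D) {S : Set ℝ} (hS : Convex ℝ S) {ψ ψ' : ℝ → T3 × V3 → ℝ} {C₁ C₂ b : ℝ}
    (hC₁ : 0 ≤ C₁) (hb : 0 < b)
    (hψ : ∀ y, ∀ s ∈ S, HasDerivWithinAt (fun s => ψ s y) (ψ' s y) S s)
    (hψ' : ∀ s ∈ S, ∀ y, |ψ' s y| ≤ C₁ * (1 + ‖y.2‖ ^ 2))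
    (hψle : ∀ s ∈ S, ∀ y, ψ s y ≤ C₂ - b * ‖y.2‖ ^ 2) (hm : ∀ s ∈ S, Measurable (ψ s))
    (hm' : ∀ s ∈ S, Measurable (ψ' s)) {s : ℝ} (hs : s ∈ S) :
    HasDerivWithinAt (fun s => ∫ z, D.indicator (fun z => Real.exp (∑ k, ψ s (z k))) z)
      (∫ z, D.indicator (fun z => Real.exp (∑ k, ψ s (z k)) * ∑ k, ψ' s (z k)) z) S s :=
  hasDerivWithinAt_integral_of_dominated_convex hS hs
    (fun _ hs => integrable_indicator_exp_sum hD hb hψle hm hs)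
    (fun _ hs z => hasDerivWithinAt_indicator_exp_sum D hψ z hs)
    (fun _ hs z => norm_indicator_exp_sum_mul_le D hC₁ hb hψ' hψle hs z)
    ((integrable_prod_exp_neg_mul_sq_norm (N + 1) (half_pos hb)).const_mul _)
    (measurable_indicator_exp_sum_mul hD (hm s hs) (hm' s hs)).aestronglyMeasurable

/-- **Continuity of the derivative of the partition integral.** Under (H1)–(H5),
`s ↦ ∫ 𝟙_D exp(∑ₖ ψ s zₖ) ∑ₖ ψ' s zₖ dz` is continuous on `S` (dominated convergence). [folklore] -/
theorem continuousOn_integral_indicator_exp_sum_mul {D : Set (Config (N + 1) (Fin 3) T3)}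
    (hD : MeasurableSet D) {S : Set ℝ} {ψ ψ' : ℝ → T3 × V3 → ℝ} {C₁ C₂ b : ℝ}
    (hC₁ : 0 ≤ C₁) (hb : 0 < b)
    (hψ : ∀ y, ∀ s ∈ S, HasDerivWithinAt (fun s => ψ s y) (ψ' s y) S s)
    (hψ' : ∀ s ∈ S, ∀ y, |ψ' s y| ≤ C₁ * (1 + ‖y.2‖ ^ 2))
    (hψle : ∀ s ∈ S, ∀ y, ψ s y ≤ C₂ - b * ‖y.2‖ ^ 2) (hm : ∀ s ∈ S, Measurable (ψ s))
    (hm' : ∀ s ∈ S, Measurable (ψ' s)) (hcont' : ∀ y, ContinuousOn (fun s => ψ' s y) S) :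
    ContinuousOn (fun s => ∫ z, D.indicator (fun z => Real.exp (∑ k, ψ s (z k)) * ∑ k, ψ' s (z k)) z) S := by
  refine continuousOn_of_dominated (fun s hs =>
      (measurable_indicator_exp_sum_mul hD (hm s hs) (hm' s hs)).aestronglyMeasurable)
    (fun s hs => ae_of_all _ fun z => norm_indicator_exp_sum_mul_le D hC₁ hb hψ' hψle hs z)
    ((integrable_prod_exp_neg_mul_sq_norm (N + 1) (half_pos hb)).const_mul _)
    (ae_of_all _ fun z => ?_)
  by_cases hz : z ∈ D
  · simp only [Set.indicator_of_mem hz]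
    have h1 : ContinuousOn (fun s => ∑ k, ψ s (z k)) S :=
      continuousOn_finsetSum _ fun k _ s hs => (hψ (z k) s hs).continuousWithinAt
    have h2 : ContinuousOn (fun s => ∑ k, ψ' s (z k)) S :=
      continuousOn_finsetSum _ fun k _ => hcont' (z k)
    exact (Real.continuous_exp.comp_continuousOn h1).mul h2
  · simp only [Set.indicator_of_notMem hz]
    exact continuousOn_const

end Core

end StubLedger

/-- Registered sub-goal `stub_ledger_core` of the stub `stub_ledger`: differentiation of the
partition integral of a Gaussian-dominated family of one-particle log-densities under the
integral sign, within a convex time set (`StubLedger.hasDerivWithinAt_integral_indicator_exp_sum`).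
[folklore] -/
theorem stub_ledger_core : ∀ {N : ℕ} {D : Set (Config (N + 1) (Fin 3) T3)}, MeasurableSet D → ∀ {S : Set ℝ}, Convex ℝ S → ∀ {ψ ψ' : ℝ → T3 × V3 → ℝ} {C₁ C₂ b : ℝ}, 0 ≤ C₁ → 0 < b → (∀ y, ∀ s ∈ S, HasDerivWithinAt (fun s => ψ s y) (ψ' s y) S s) → (∀ s ∈ S, ∀ y, |ψ' s y| ≤ C₁ * (1 + ‖y.2‖ ^ 2)) → (∀ s ∈ S, ∀ y, ψ s y ≤ C₂ - b * ‖y.2‖ ^ 2) → (∀ s ∈ S, Measurable (ψ s)) → (∀ s ∈ S, Measurable (ψ' s)) → ∀ {s : ℝ}, s ∈ S → HasDerivWithinAt (fun s => ∫ z, D.indicator (fun z => Real.exp (∑ k, ψ s (z k))) z) (∫ z, D.indicator (fun z => Real.exp (∑ k, ψ s (z k)) * ∑ k, ψ' s (z k)) z) S s :=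
  fun hD _ hS _ _ _ _ _ hC₁ hb hψ hψ' hψle hm hm' _ hs =>
    StubLedger.hasDerivWithinAt_integral_indicator_exp_sum hD hS hC₁ hb hψ hψ' hψle hm hm' hs

end Summit.AtomisticToContinuum.HydrodynamicLimit.Theorems.MacroClosureLine

end
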